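import Literature.MathematicalPhysics.QuantumLattice.SymmetricRegimeFunctionals
import Literature.MathematicalPhysics.QuantumLattice.HubbardEffectiveActionCTSymmetry
import HarnessLib

/-!
# `D₄` covariance of the symmetric-regime certificate functionals

Topic `MathematicalPhysics/QuantumLattice`; companion of `SymmetricRegimeFunctionals.lean` (the
self-energy `selfEnergy`, field strengths `fieldStrengthSpin`/`fieldStrength`, BCS shell measure
`bcsMeasure`, Cooper amplitude `cooperAmplitude` and Cooper matrix `cooperMatrix` of an element
`G : HubbardGrassmann L M`) and of `HubbardEffectiveActionCTSymmetry.lean` (the kernels of the seedless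
countertermed effective action `hubbardEffectiveActionCT L M β U μ 0 K Λ` are invariant under the
relabelling `𝔡[L, M, γ]` of all their arguments, `γ ∈ D₄` acting on the spatial momentum by `d4Site`).

For ANY `G` whose kernels are `D₄`-invariant in this sense (hypothesis `hG`), the functionals built from
values of the `2`- and `4`-point kernels at `D₄`-related label configurations are covariant:

* `selfEnergy_d4Site` — `Σ((ω, γk⃗), σ) = Σ((ω, k⃗), σ)`; `fieldStrengthSpin_d4Site`, `fieldStrength_d4Site`,
  `bcsMeasure_d4Site` (uses `γ(-k⃗) = -γk⃗`);
* `cooperAmplitude_d4Site` — `𝒞(γk⃗, γk⃗') = 𝒞(k⃗, k⃗')` (the pair labels `(k⃗↑, -k⃗↓)` are permuted among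
  themselves because `γ` is additive);
* **`cooperMatrix_d4Site`** — for a `D₄`-invariant renormalised band `e` (so that the shell `S_Λ` is
  `D₄`-stable), `A(γk⃗, γk⃗') = A(k⃗, k⃗')`: the Cooper matrix commutes with the permutation
  representation of `D₄` on `ℓ²((ℤ/Lℤ)²)`, hence is block diagonal in the `C₄ᵥ` symmetry sectors
  (`A₁g, A₂g, B₁g, B₂g, E`; Scalapino 1995 §2);

and the instances for the seedless countertermed effective action in the frame `K` with the band
`e_K = nambuXiCT L μ K` (`selfEnergy_hubbardEffectiveActionCT_d4Site`,
`fieldStrength_hubbardEffectiveActionCT_d4Site`, **`cooperMatrix_hubbardEffectiveActionCT_d4Site`**).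

## Sources

D. J. Scalapino, Phys. Rep. 250 (1995) 329, §2 (classification of the pair channels of the square
lattice by the irreducible representations of `C₄ᵥ`) [`Scalapino1995`]; G. Benfatto, A. Giuliani,
V. Mastropietro, Ann. Henri Poincaré 7 (2006) 809, §2.1 (lattice symmetries of the effective
potentials) [`BenfattoGiulianiMastropietro2006`].  Routine consequences ("folklore"); no definitions.
-/

noncomputable section

namespace Literature.MathematicalPhysics.QuantumLattice

open Literature.Probability.LatticeModels GrassmannAlgebra Finset Matrix

section Functionals

/-! Throughout this section `hG` says that the kernels of `G` are invariant under the relabelling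
`((ω, k⃗), σ, c) ↦ ((ω, γ k⃗), σ, c)` of all their arguments (the permutation `𝔡[L, M, γ]` of
`HubbardEffectiveActionCTSymmetry.lean`, written out). -/

variable (L M : ℕ) {G : HubbardGrassmann L M} {γ : DihedralGroup 4}
  (hG : ∀ (m : ℕ) (X : Fin m → HubbardFieldIdx L M),
    kernel ℂ G m ((Equiv.prodCongr (Equiv.prodCongr (Equiv.prodCongr (Equiv.refl (MatsubaraIdx M)) (d4SitePerm γ))
      (Equiv.refl (Fin 2))) (Equiv.refl (Fin 2))) ∘ X) = kernel ℂ G m X)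

include hG

/-- **The self-energy of a `D₄`-invariant `G` is `D₄`-invariant**: `Σ((ω, γk⃗), σ) = Σ((ω, k⃗), σ)`. [folklore] -/
theorem selfEnergy_d4Site (β : ℝ) (ω : MatsubaraIdx M) (p : TorusSite 2 L) (s : Fin 2) :
    selfEnergy L M β G (ω, d4Site γ p) s = selfEnergy L M β G (ω, p) s := by
  rw [selfEnergy, selfEnergy, vertexFn, vertexFn, ← hG 2 ![(((ω, p), s), 0), (((ω, p), s), 1)]]
  congr 2
  funext i
  fin_cases i <;> rfl

variable [NeZero M]

/-- The field strength at each spin of a `D₄`-invariant `G` is `D₄`-invariant. [folklore] -/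
theorem fieldStrengthSpin_d4Site (β : ℝ) (p : TorusSite 2 L) (s : Fin 2) :
    fieldStrengthSpin L M β G (d4Site γ p) s = fieldStrengthSpin L M β G p s := by
  rw [fieldStrengthSpin, fieldStrengthSpin, selfEnergy_d4Site L M hG, selfEnergy_d4Site L M hG]

/-- The field strength `z(k⃗)` of a `D₄`-invariant `G` is `D₄`-invariant. [folklore] -/
theorem fieldStrength_d4Site (β : ℝ) (p : TorusSite 2 L) : fieldStrength L M β G (d4Site γ p) = fieldStrength L M β G p := by
  rw [fieldStrength, fieldStrength, fieldStrengthSpin_d4Site L M hG, fieldStrengthSpin_d4Site L M hG]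

/-- The BCS shell measure `ν_Λ(k⃗) = 1/(Λ L² (z(k⃗) + z(-k⃗)))` of a `D₄`-invariant `G` is `D₄`-invariant
(`γ(-k⃗) = -γk⃗`). [folklore] -/
theorem bcsMeasure_d4Site (β Λ : ℝ) (p : TorusSite 2 L) : bcsMeasure L M β Λ G (d4Site γ p) = bcsMeasure L M β Λ G p := by
  rw [bcsMeasure, bcsMeasure, ← d4Site_neg, fieldStrength_d4Site L M hG, fieldStrength_d4Site L M hG]

/-- **The Cooper amplitude of a `D₄`-invariant `G` is `D₄`-covariant**: `𝒞(γk⃗, γk⃗') = 𝒞(k⃗, k⃗')` (the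
pair labels `(ω₀, k⃗)↑, (-ω₀, -k⃗)↓` are mapped to those of `γk⃗`, as `γ(-k⃗) = -γk⃗`). [folklore] -/
theorem cooperAmplitude_d4Site (β : ℝ) (k k' : TorusSite 2 L) :
    cooperAmplitude L M β G (d4Site γ k) (d4Site γ k') = cooperAmplitude L M β G k k' := by
  rw [cooperAmplitude, cooperAmplitude, vertexFn, vertexFn,
    ← hG 4 ![(((omega0 M, k'), 0), 0), ((FreqMomentum.neg (omega0 M, k'), 1), 0),
      ((FreqMomentum.neg (omega0 M, k), 1), 1), (((omega0 M, k), 0), 1)]]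
  congr 2
  funext i
  fin_cases i
  · rfl
  · simp [FreqMomentum.neg, d4Site_neg]
  · simp [FreqMomentum.neg, d4Site_neg]
  · rfl

/-- **The Cooper matrix of a `D₄`-invariant `G` over a `D₄`-invariant band commutes with `D₄`**:
`A(γk⃗, γk⃗') = A(k⃗, k⃗')` (shell, BCS measure and amplitude are all covariant), i.e. `A` commutes with the
permutation representation of the point group on `ℓ²((ℤ/Lℤ)²)` and is block diagonal in the `C₄ᵥ`
sectors (Scalapino 1995 §2). [folklore] -/
theorem cooperMatrix_d4Site [NeZero L] {e : TorusSite 2 L → ℝ} (he : ∀ k, e (d4Site γ k) = e k) (β Λ : ℝ) (k k' : TorusSite 2 L) :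
    cooperMatrix L M β e Λ G (d4Site γ k) (d4Site γ k') = cooperMatrix L M β e Λ G k k' := by
  simp only [cooperMatrix, Matrix.of_apply, mem_momentumShell, he, bcsMeasure_d4Site L M hG,
    cooperAmplitude_d4Site L M hG]

end Functionals

/-! ### The instances for the seedless countertermed effective action -/

section CT

variable (L M : ℕ) [NeZero L]

/-- The self-energy of `𝒢^K_Λ` (seed `h = 0`) is `D₄`-invariant in the momentum. [folklore] -/
theorem selfEnergy_hubbardEffectiveActionCT_d4Site (β U μ : ℝ) (K : TrigPolyC4v) (Λ : ℝ) (γ : DihedralGroup 4)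
    (ω : MatsubaraIdx M) (p : TorusSite 2 L) (s : Fin 2) :
    selfEnergy L M β (hubbardEffectiveActionCT L M β U μ 0 K Λ) (ω, d4Site γ p) s =
      selfEnergy L M β (hubbardEffectiveActionCT L M β U μ 0 K Λ) (ω, p) s :=
  selfEnergy_d4Site L M (kernel_hubbardEffectiveActionCT_d4Field L M γ β U μ K Λ) β ω p s

variable [NeZero M]

/-- The field strength of `𝒢^K_Λ` (seed `h = 0`) is `D₄`-invariant. [folklore] -/
theorem fieldStrength_hubbardEffectiveActionCT_d4Site (β U μ : ℝ) (K : TrigPolyC4v) (Λ : ℝ) (γ : DihedralGroup 4)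
    (p : TorusSite 2 L) :
    fieldStrength L M β (hubbardEffectiveActionCT L M β U μ 0 K Λ) (d4Site γ p) =
      fieldStrength L M β (hubbardEffectiveActionCT L M β U μ 0 K Λ) p :=
  fieldStrength_d4Site L M (kernel_hubbardEffectiveActionCT_d4Field L M γ β U μ K Λ) β p

/-- **`D₄` covariance of the Cooper matrix of the countertermed effective action** (seed `h = 0`,
band `e_K = ε_L - μ - K`): `A(γk⃗, γk⃗') = A(k⃗, k⃗')` for every `γ ∈ D₄` — the point group of the square
lattice acts on the torus momenta, the CT covariance, the cutoff and the Hubbard vertex are invariant,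
hence so is the effective action and every kernel functional built from it covariantly. [folklore] -/
theorem cooperMatrix_hubbardEffectiveActionCT_d4Site (β U μ Λ : ℝ) (K : TrigPolyC4v) (γ : DihedralGroup 4)
    (k k' : TorusSite 2 L) :
    cooperMatrix L M β (nambuXiCT L μ K) Λ (hubbardEffectiveActionCT L M β U μ 0 K Λ) (d4Site γ k) (d4Site γ k') =
      cooperMatrix L M β (nambuXiCT L μ K) Λ (hubbardEffectiveActionCT L M β U μ 0 K Λ) k k' :=
  cooperMatrix_d4Site L M (kernel_hubbardEffectiveActionCT_d4Field L M γ β U μ K Λ) (nambuXiCT_d4Site μ K γ)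
    β Λ k k'

end CT

end Literature.MathematicalPhysics.QuantumLattice
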